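import Summits.ResolutionOfSingularities.ResolutionOfSingularities.Theorems.HilbertSamuelEliminationSigmaMaxModificationsCorridor3ConfinedSetup
import Summits.ResolutionOfSingularities.ResolutionOfSingularities.Theorems.HilbertSamuelEliminationSigmaMaxModificationsCorridor3NuGluingFinite
import Summits.ResolutionOfSingularities.ResolutionOfSingularities.Theorems.HilbertSamuelEliminationSigmaMaxModificationsCorridor3NuGluingChart
import Literature.AlgebraicGeometry.Resolution.MarkedIdeals
import Literature.AlgebraicGeometry.Resolution.BlowupSequences
import Mathlib.AlgebraicGeometry.Morphisms.ClosedImmersion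
import Mathlib.AlgebraicGeometry.PullbackCarrier
import Mathlib.FieldTheory.Perfect
import HarnessLib

/-!
# Route `HilbertSamuelElimination`, crux `SigmaMaxModificationsCorridor3`
# (stmt-ResolutionOfSingularities-19249; child of `SigmaMaxModifications` stmt-…-18506),
# line `tame_wild` v3 (confined form) — ASSEMBLY of the confined transfer over ONE image point,
# modulo the typed bricks T0–T4 (lead's helpers-v3)

[OURS · L1 W4.2] Kernel check of the architecture of the registered stub
`stub_confinedTameNu3_of_thor4`: from the five remaining bricks T0 (bridge `IsMarkedResolution` →
`CentreSeq.IsResolutionOf`), T1 (per-chart transfer), T2 (hypersurface chart at a closed stratum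
point), T3 (embedded tower), T4 (chart dictionary) — taken here as HYPOTHESES with the exact
signatures of `L/res-L1-w42-lead-1/helpers-v3.lean` — and tame hypersurface order reduction THOR₄
at `p`, a confining sequence whose top stratum maps to ONE closed point yields the `ν`-modification.
Uses the landed set-up (p480065), per-chart packaging (p479629), two-chart merge (p478407), identity
witness and passage to `NuMod` (p478884), transitivity (p475565), and `CentreSeq.restrict` (tree).
The general case (finitely many image points) iterates the merge over separated charts. NOT a
statement of any manuscript; no theorem here closes an item.

## Sources

* V. Cossart, U. Jannsen, S. Saito, LNM 2270 (2020), Def. 6.14, Rem. 6.24, Thm. 3.10 (1).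
  [CossartJannsenSaito2020]
* E. Bierstone, D. Grigoriev, P. Milman, J. Włodarczyk, arXiv:1206.3090, Def. 3.1.3–3.1.5,
  Thm. 8.0.5. [BierstoneGrigorievMilmanWlodarczyk2011]
* The Stacks Project, Tags 01LH, 080E. [StacksProject]
-/

set_option linter.dupNamespace false -- mandated namespace of this single-conjunct summit

noncomputable section

open CategoryTheory AlgebraicGeometry TopologicalSpace Topology
open Literature.AlgebraicGeometry.Resolution Literature.RingTheory.HilbertSamuel
open Summit.ResolutionOfSingularities.ResolutionOfSingularities.Theorems.SigmaMaxModifications.Sketch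

namespace Summit.ResolutionOfSingularities.ResolutionOfSingularities.Theorems.SigmaMaxModificationsCorridor3.TameWild

/-- **The confined transfer over ONE image point, modulo the bricks T0–T4 and THOR₄.** Hypotheses
`hT0 … hT4` are verbatim the typed signatures of helpers-v3; `hthor` is the statement of the
registered `stub_thor4` at `p`. Given `Y/k` (perfect `k` of characteristic `p`) reduced, separated,
of finite type, `dim Y ≤ 3`, a maximal value `ν = hypersurfaceHF m` (`1 ≤ m < p`), and a blow-up
sequence `s` in regular centres over `Y(ν)`, `H^3`-monotone, whose top stratum maps into a single
closed point `y`: `NuMod Y 3 3 ν`. Route: set-up on `s.top` (p480065); chart at `y` (T2);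
restrict `s` over the chart (`CentreSeq.restrict`, regular centres); climb the tower (T3); dictionary
(T4); THOR₄; bridge (T0); transfer (T1); package the chart witness (p479629); merge with the identity
of the complement of the top stratum (p478407, p478884); compose with `s` (p475565).
[cite: CossartJannsenSaito2020, Def. 6.14, Rem. 6.24] [cite: BierstoneGrigorievMilmanWlodarczyk2011, Thm. 8.0.5] -/
theorem confinedNu3_onePoint_of_bricks (p : ℕ)
    -- T0: bridge
    (hT0 : ∀ {X : Scheme.{0}} (M : MarkedIdeal X) {X' : Scheme.{0}} (Φ : X' ⟶ X)
      (M' : MarkedIdeal X'), IsMarkedResolution M Φ M' → ∃ s : CentreSeq X, s.IsResolutionOf M)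
    -- T1: per-chart transfer
    (hT1 : ∀ (k : Type) [Field k] (Y : Scheme.{0}) (g : Y ⟶ Spec (.of k))
      [LocallyOfFiniteType g] [IsReduced Y], topologicalKrullDim Y ≤ ((3 : ℕ) : WithBot ℕ∞) →
      ∀ (ν : ℕ → ℕ), Maximal (· ∈ Scheme.hsValues Y 3) ν → ∀ (m : ℕ), 1 ≤ m →
      ∀ (V : Scheme.{0}) (j : V ⟶ Y) [IsOpenImmersion j] (Z : Scheme.{0}), Scheme.IsRegular Z →
      ∀ (I : Z.IdealSheafData), IsEffectiveCartier I → ∀ (ι : V ⟶ Z) [IsClosedImmersion ι],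
      ι.ker = I →
      (⟨I, [], m⟩ : MarkedIdeal Z).support = ι.base '' Scheme.hsStratum V 3 ν →
      (∀ z : Z, idealOrder I z ≤ (m : ℕ∞)) →
      ∀ (t : CentreSeq Z), t.IsResolutionOf (⟨I, [], m⟩ : MarkedIdeal Z) →
      ∃ s : CentreSeq V, s.AllRegular ∧ s.CentresOver (Scheme.hsStratum V 3 ν) ∧
        (∀ x' : s.top, Scheme.hsFun s.top 3 x' ≤ Scheme.hsFun V 3 (s.comp.base x')) ∧
        ν ∉ Scheme.hsValues s.top 3)
    -- T2: hypersurface chart at a closed stratum point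
    (hT2 : ∀ (p : ℕ), p.Prime → ∀ (k : Type) [Field k] [CharP k p] [PerfectField k]
      (Y : Scheme.{0}) (g : Y ⟶ Spec (.of k)) [LocallyOfFiniteType g] [IsReduced Y],
      topologicalKrullDim Y ≤ ((3 : ℕ) : WithBot ℕ∞) → ∀ (ν : ℕ → ℕ),
      Maximal (· ∈ Scheme.hsValues Y 3) ν → ∀ (m : ℕ), 2 ≤ m → ν = hypersurfaceHF m →
      ∀ (y : Y), y ∈ Scheme.hsStratum Y 3 ν → IsClosed ({y} : Set Y) →
      ∀ (A : Set Y), A.Finite → (∀ a ∈ A, IsClosed ({a} : Set Y)) → y ∉ A →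
      ∃ (U : Y.Opens) (_ : y ∈ U) (Z : Scheme.{0}) (h : Z ⟶ Spec (.of k)) (I : Z.IdealSheafData)
        (ι : (U : Scheme.{0}) ⟶ Z),
        Disjoint (U : Set Y) A ∧ IsSeparated h ∧ LocallyOfFiniteType h ∧ QuasiCompact h ∧
        IsIntegral Z ∧ Scheme.IsRegular Z ∧ IsAffine Z ∧
        topologicalKrullDim Z ≤ ((4 : ℕ) : WithBot ℕ∞) ∧ I ≠ ⊥ ∧ IsEffectiveCartier I ∧
        IsClosedImmersion ι ∧ ι ≫ h = U.ι ≫ g ∧ ι.ker = I ∧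
        (⟨I, [], m⟩ : MarkedIdeal Z).support = ι.base '' Scheme.hsStratum (U : Scheme.{0}) 3 ν ∧
        ∀ z : Z, idealOrder I z ≤ (m : ℕ∞))
    -- T3: embedded tower
    (hT3 : ∀ (k : Type) [Field k] (U Z : Scheme.{0}) (h : Z ⟶ Spec (.of k))
      [IsSeparated h] [LocallyOfFiniteType h] [QuasiCompact h], IsIntegral Z →
      Scheme.IsRegular Z → topologicalKrullDim Z ≤ ((4 : ℕ) : WithBot ℕ∞) →
      ∀ (I : Z.IdealSheafData), I ≠ ⊥ → IsEffectiveCartier I → ∀ (ι : U ⟶ Z)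
      [IsClosedImmersion ι], ι.ker = I → ∀ (r : CentreSeq U), r.AllRegular →
      ∃ (Z' : Scheme.{0}) (h' : Z' ⟶ Spec (.of k)) (I' : Z'.IdealSheafData) (ι' : r.top ⟶ Z'),
        IsSeparated h' ∧ LocallyOfFiniteType h' ∧ QuasiCompact h' ∧ IsIntegral Z' ∧
        Scheme.IsRegular Z' ∧ topologicalKrullDim Z' ≤ ((4 : ℕ) : WithBot ℕ∞) ∧ I' ≠ ⊥ ∧
        IsEffectiveCartier I' ∧ IsClosedImmersion ι' ∧ ι' ≫ h' = r.comp ≫ ι ≫ h ∧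
        ι'.ker = I')
    -- T4: chart dictionary
    (hT4 : ∀ (k : Type) [Field k] (Y : Scheme.{0}) (g : Y ⟶ Spec (.of k))
      [LocallyOfFiniteType g] [IsReduced Y], topologicalKrullDim Y ≤ ((3 : ℕ) : WithBot ℕ∞) →
      ∀ (ν : ℕ → ℕ) (m : ℕ), 1 ≤ m → ν = hypersurfaceHF m →
      (ν ∉ Scheme.hsValues Y 3 ∨ Maximal (· ∈ Scheme.hsValues Y 3) ν) →
      ∀ (V : Scheme.{0}) (j : V ⟶ Y) [IsOpenImmersion j] (Z : Scheme.{0}), Scheme.IsRegular Z →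
      topologicalKrullDim Z ≤ ((4 : ℕ) : WithBot ℕ∞) → ∀ (I : Z.IdealSheafData), I ≠ ⊥ →
      IsEffectiveCartier I → ∀ (ι : V ⟶ Z) [IsClosedImmersion ι], ι.ker = I →
      (⟨I, [], m⟩ : MarkedIdeal Z).support = ι.base '' Scheme.hsStratum V 3 ν ∧
        ∀ z : Z, idealOrder I z ≤ (m : ℕ∞))
    -- THOR₄ at `p`
    (hthor : ∀ (k : Type) [Field k] [CharP k p] [PerfectField k] (Z : Scheme.{0})
      (h : Z ⟶ Spec (.of k)), IsSeparated h → LocallyOfFiniteType h → QuasiCompact h →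
      IsIntegral Z → Scheme.IsRegular Z → topologicalKrullDim Z ≤ ((4 : ℕ) : WithBot ℕ∞) →
      ∀ (I : Z.IdealSheafData), I ≠ ⊥ → IsEffectiveCartier I → ∀ m : ℕ, 1 ≤ m → m < p →
        ∃ (Z' : Scheme.{0}) (Φ : Z' ⟶ Z) (M' : MarkedIdeal Z'),
          IsMarkedResolution (⟨I, [], m⟩ : MarkedIdeal Z) Φ M')
    -- the frame
    (hp : p.Prime) (k : Type) [Field k] [CharP k p] [PerfectField k] (Y : Scheme.{0})
    (g : Y ⟶ Spec (.of k)) [LocallyOfFiniteType g] [QuasiCompact g] [IsReduced Y]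
    (hd3 : topologicalKrullDim Y ≤ ((3 : ℕ) : WithBot ℕ∞)) (ν : ℕ → ℕ)
    (hν : Maximal (· ∈ Scheme.hsValues Y 3) ν) (m : ℕ) (hm2 : 2 ≤ m) (hmp : m < p)
    (hνm : ν = hypersurfaceHF m)
    -- the confining sequence, over ONE closed point
    (s : CentreSeq Y) (hreg : s.AllRegular) (hover : s.CentresOver (Scheme.hsStratum Y 3 ν))
    (hmono : ∀ x' : s.top, Scheme.hsFun s.top 3 x' ≤ Scheme.hsFun Y 3 (s.comp.base x'))
    (y : Y) (hyc : IsClosed ({y} : Set Y))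
    (himg : (fun x' => s.comp.base x') '' Scheme.hsStratum s.top 3 ν ⊆ {y}) :
    NuMod Y 3 3 ν := by
  haveI : IsLocallyNoetherian Y := LocallyOfFiniteType.isLocallyNoetherian g
  have hm1 : 1 ≤ m := by omega
  -- Step 1: set-up on `s.top`
  rcases nuMod_or_setup_top g hd3 hd3 hν s hover hmono with hdone | ⟨hmax', hcl, hsred, hsd, -, hlft, hqc⟩
  · exact hdone
  haveI := hsred
  haveI := hlft
  haveI := hqc
  haveI : IsLocallyNoetherian s.top := LocallyOfFiniteType.isLocallyNoetherian (s.comp ≫ g)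
  -- the top stratum is non-empty (ν is a value), so `y ∈ Y(ν)`
  obtain ⟨x₀, hx₀⟩ := hmax'.1
  have hx₀S : x₀ ∈ Scheme.hsStratum s.top 3 ν := by rw [Scheme.mem_hsStratum_iff]; exact hx₀
  have hyx₀ : s.comp.base x₀ = y := himg ⟨x₀, hx₀S, rfl⟩
  have hy : y ∈ Scheme.hsStratum Y 3 ν := by
    rw [Scheme.mem_hsStratum_iff, ← hyx₀]
    have h1 : ν ≤ Scheme.hsFun Y 3 (s.comp.base x₀) := hx₀ ▸ hmono x₀
    exact le_antisymm (hν.2 ⟨_, rfl⟩ h1) h1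
  -- Step 2: a hypersurface chart at `y`
  obtain ⟨U, hyU, Z, h, I, ι, -, hsep, hlftZ, hqcZ, hZi, hZ, -, hdimZ, hI0, hI, hιc, hιh, hker,
    -, -⟩ := hT2 p hp k Y g hd3 ν hν m hm2 hνm y hy hyc ∅ Set.finite_empty (fun a ha => ha.elim)
      (Set.notMem_empty y)
  haveI := hsep; haveI := hlftZ; haveI := hqcZ; haveI := hιc
  -- Step 3: restrict the confining sequence over the chart
  let r : CentreSeq (U : Scheme.{0}) := s.restrict U.ι
  have hr : r.AllRegular := CentreSeq.AllRegular.restrict s U.ι hreg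
  let j : r.top ⟶ s.top := s.restrictι U.ι
  haveI : IsOpenImmersion j := CentreSeq.isOpenImmersion_restrictι s U.ι
  -- Step 4: climb the embedded tower
  obtain ⟨Z', h', I', ι', hsep', hlft', hqc', hZi', hZ', hdimZ', hI0', hI', hιc', hιh', hker'⟩ :=
    hT3 k (U : Scheme.{0}) Z h hZi hZ hdimZ I hI0 hI ι hker r hr
  haveI := hιc'
  -- Step 5: the dictionary at the top of the tower
  obtain ⟨hsupp', hord'⟩ := hT4 k s.top (s.comp ≫ g) hsd ν m hm1 hνm (Or.inr hmax') r.top j Z' hZ'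
    hdimZ' I' hI0' hI' ι' hker'
  -- Step 6: THOR₄ on the top chart, bridged to a `CentreSeq`
  obtain ⟨Z'', Φ, M', hres⟩ := hthor k Z' h' hsep' hlft' hqc' hZi' hZ' hdimZ' I' hI0' hI' m hm1 hmp
  obtain ⟨t, ht⟩ := hT0 _ Φ M' hres
  -- Step 7: the per-chart transfer
  obtain ⟨s₁, hreg₁, hover₁, hmono₁, hkill₁⟩ :=
    hT1 k s.top (s.comp ≫ g) hsd ν hmax' m hm1 r.top j Z' hZ' I' hI' ι' hker' hsupp' hord' t ht
  -- Step 8: package the chart witness (structure-map form)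
  let Zc : s.top.Opens := ⟨(Scheme.hsStratum s.top 3 ν)ᶜ, hcl.isOpen_compl⟩
  have hZc : ((Zc : s.top.Opens) : Set s.top) = (Scheme.hsStratum s.top 3 ν)ᶜ := rfl
  obtain ⟨hnW, hrW, hpW, hredW, hdW, hNW, hisoW, hdenseW, hmonoW, hkillW⟩ :=
    localWitness_of_centreSeq_openImmersion s.top 3 3 ν hsd hsd Zc hZc.le r.top j s₁ hover₁ hmono₁
      hkill₁
  -- Step 9: the chart contains the whole top stratum (it lies over `y ∈ U`)
  have hcov : Zc ⊔ j.opensRange = ⊤ := by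
    ext x'
    simp only [Opens.coe_sup, Opens.coe_top, Set.mem_univ, iff_true]
    by_cases hx' : x' ∈ Scheme.hsStratum s.top 3 ν
    · right
      have hyx' : s.comp.base x' = y := himg ⟨x', hx', rfl⟩
      obtain ⟨q, hq, -⟩ := Scheme.exists_preimage_of_isPullback
        (CentreSeq.isPullback_restrict s U.ι) x' ⟨y, hyU⟩ (by rw [hyx']; rfl)
      exact Scheme.Hom.mem_opensRange.mpr ⟨q, hq⟩
    · exact Or.inl hx'
  -- Step 10: merge with the identity of `Zc` and pass to `NuMod s.top`
  obtain ⟨hn₂, hr₂, hp₂, hred₂, hd₂, hN₂, hiso₂, hdense₂, hmono₂, hkill₂⟩ :=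
    localWitness_compl s.top 3 3 ν hsd hsd Zc hZc
  obtain ⟨W, a, -, -, hpa, hreda, hda, hNa, hisoa, hdensea, hmonoa, hkilla⟩ :=
    exists_localWitness_sup s.top 3 3 ν Zc j.opensRange Zc inf_le_right s₁.top (s₁.comp ≫ j) hnW hrW
      hpW hredW hdW hNW hisoW hdenseW hmonoW hkillW (Zc : Scheme.{0}) Zc.ι hn₂ hr₂ hp₂ hred₂ hd₂ hN₂
      hiso₂ hdense₂ hmono₂ hkill₂
  have htop : j.opensRange ⊔ Zc = ⊤ := by rw [sup_comm]; exact hcov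
  have hNuTop : NuMod s.top 3 3 ν := by
    refine nuMod_of_localWitness_top s.top 3 3 ν Zc hZc W a (fun x => ?_) hreda hda hNa
      (isIso_morphismRestrict_of_le a hisoa (le_inf le_sup_right le_rfl)) hdensea hmonoa hkilla
    have hx : x ∈ j.opensRange ⊔ Zc := by rw [htop]; exact Opens.mem_top x
    exact hpa x hx
  -- Step 11: compose with the confining sequence
  exact nuMod_of_centreSeq_of_nuMod 3 3 hd3 ν hν s hover hmono hNuTop

end Summit.ResolutionOfSingularities.ResolutionOfSingularities.Theorems.SigmaMaxModificationsCorridor3.TameWild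

end
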